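import HarnessLib
import Summits.QuantumFields.YangMills.Theorems.PencilRigidityHypercubicLimitDefs
import Summits.QuantumFields.YangMills.Theorems.LangevinControlUVOSLegsFromFemtoAndGapDefs
import Summits.QuantumFields.YangMills.Theorems.LangevinControlUVOSLegsFromFemtoAndGapStubAssemblyLatticeDist
import Summits.QuantumFields.YangMills.Theorems.LangevinControlUVOSLegsFromFemtoAndGapStubAssemblyPlaneStrings

/-!
# Crux `HypercubicLimit` (stmt-QuantumFields-8646), line `conditional-mean-telescoping`: (U) from the scaled bound

Registered sub-goal `uniformBound_of_scaledShiftedBound` (SG2, c2 seat, reshape 3): the a-uniform E0′-type bound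
(U) `UniformBound` on the RP-normalised plane-string distributions follows from

* the abstract **scaled shifted bound** (sub-goal SG1 `stub_scaledShiftedBound`, taken here UNFOLDED as a
  hypothesis): for weights with a sup bound `Mⁿ` and a separated bound `(B (R₀/R)^P)ⁿ`,
  `a⁴ⁿ ‖Σₓ W(x) F(y(x))‖ ≤ Kⁿ (Bⁿ + Mⁿ a^{En}) ‖F‖_{sn}`;
* **Gaussian domination** of separated centred plaquette moments (`GaussianDomination`);
* **window regularity** of the reference RP square (`WindowRegularity` (a) doubling, (c) floor);
* `GapData` (i): `0 < m(β) → 0`.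

In units `a = m(β)`, with `R₀ = ⌊δ₀/a⌋` and `N = rpSquare r β S R₀ = refSquare r β S δ₀ a`:
the floor and the doubling give `a^Q ≤ C_W R₀^P N`, whence `N > 0`, `C_W > 0` and `a^{P+Q} ≤ C_W δ₀^P N`;
the plane-string weight `planeWeight r β S q x` IS the centred torus moment of Gaussian domination
(`planeWeight_eq_integral`: translation covariance of the plaquette observable and translation invariance of
the torus means), so the separated bound holds with `B = |C_G| n^γ √C_W √N` (doubling
`√A(R) ≤ √C_W (R₀/R)^P √N`),
the sup bound with `M = 2N_ρ` (unitarity), and the abstract bound at `(δ₀, P, P+Q)` closes with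
`K = K_S (|C_G| √C_W + 2N_ρ √(C_W δ₀^P))`.

Refs: `PencilRigidityHypercubicLimitDefs.lean` §§3, 5, 7; OsterwalderSchrader1975 §2 (E0′); GlimmJaffe1987 §6.1.
-/

set_option autoImplicit false

noncomputable section

open scoped SchwartzMap ENNReal
open MeasureTheory Filter Topology
open Literature.MathematicalPhysics.AQFT Literature.MathematicalPhysics.QuantumLattice
open Literature.MathematicalPhysics.QuantumFieldTheory
open Literature.Probability.LatticeModels (box Site)
open Summit.QuantumFields.YangMills.Theorems.HypercubicLimit.Negative
  (torusPlaquette torusDensity rpSquare influence)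
open Summit.QuantumFields.YangMills.Theorems.OSLegsFromFemtoAndGap (torusMomentStr latticeDistStr latticeDist)
open Summit.QuantumFields.YangMills.Cruxes.OSLegsFromFemtoAndGap.DlrCollarTransfer (Q2 Q3)
open Summit.QuantumFields.YangMills.Cruxes.OSLegsFromFemtoAndGap.DlrCollarTransfer (torusE plane)
open Summit.QuantumFields.YangMills.Theorems.OSLegsFromFemtoAndGap
  (torusE_comp_configShift abs_torusMomentStr_plane_le)
open Summit.QuantumFields.YangMills.Theorems.CurvatureBoostCovariance.Negative
  (plaquetteObs_configShift_torusLift plaquetteHolonomyZd_torusLift')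
open Summit.QuantumFields.YangMills.Theorems.HypercubicLimit.Negative (rpSquare_nonneg)

namespace Summit.QuantumFields.YangMills.Cruxes.HypercubicLimit.ConditionalMeanTelescoping

section PlaneWeights

variable {G : Type} [Group G] [TopologicalSpace G] [IsTopologicalGroup G] [CompactSpace G]
  [MeasurableSpace G] [BorelSpace G]

omit [IsTopologicalGroup G] [CompactSpace G] [BorelSpace G] in
/-- **Translation covariance of the torus plaquette**: the plaquette of orientation `p` based at `z` on the torus
is the origin plane field `planeObs r p` of the configuration translated by `−z`. -/
theorem torusPlaquette_eq_planeObs (r : LatticeRep G) (L : ℕ) (p : Fin 4 × Fin 4) (z : Site 4)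
    (U : GaugeConfig 4 L G) :
    torusPlaquette r L p.1 p.2 z U = planeObs r p (configShift (-z) (torusLift L U)) := by
  unfold torusPlaquette planeObs
  rw [plaquetteObs_configShift_torusLift]
  unfold plaquetteObs
  rw [plaquetteHolonomyZd_torusLift']

/-- **The torus mean of a torus plaquette is the `wilsonTorusMean` of its origin plane field** (translation
invariance of Wilson's measure on the torus). -/
theorem integral_torusPlaquette (r : LatticeRep G) (β : ℝ) (S : ℕ) (p : Fin 4 × Fin 4) (z : Site 4) :
    ∫ V, torusPlaquette r (2 * S + 1) p.1 p.2 z V ∂(wilsonMeasure (d := 4) (L := 2 * S + 1) r.ρ β) =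
      wilsonTorusMean r.ρ β S (planeObs r p) := by
  have h := torusE_comp_configShift r β S (planeObs r p) z
  unfold torusE at h
  rw [← h]
  simp only [torusPlaquette_eq_planeObs, Function.comp_apply]

/-- **The plane-string weight is the centred torus moment of Gaussian domination**:
`planeWeight r β S q x = ∫ ∏ₖ (p_{qₖ}(xₖ) − ∫ p_{qₖ}(xₖ)) dμ_{β,2S+1}`. -/
theorem planeWeight_eq_integral (r : LatticeRep G) (β : ℝ) (S : ℕ) {n : ℕ} (q : Fin n → Fin 4 × Fin 4)
    (x : Fin n → Site 4) :
    planeWeight r β S q x =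
      ∫ U, ∏ k, (torusPlaquette r (2 * S + 1) (q k).1 (q k).2 (x k) U -
        ∫ V, torusPlaquette r (2 * S + 1) (q k).1 (q k).2 (x k) V
          ∂(wilsonMeasure (d := 4) (L := 2 * S + 1) r.ρ β))
        ∂(wilsonMeasure (d := 4) (L := 2 * S + 1) r.ρ β) := by
  simp only [integral_torusPlaquette]
  simp only [torusPlaquette_eq_planeObs]
  rfl

/-- **Sup bound** `|W^{q}(x)| ≤ (N_ρ + N_ρ)ⁿ` for the plane-string weights (unitarity of `r.ρ`). -/
theorem abs_planeWeight_le (r : LatticeRep G) (β : ℝ) (S : ℕ) {n : ℕ} (q : Fin n → Fin 4 × Fin 4)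
    (x : Fin n → Site 4) :
    |planeWeight r β S q x| ≤ ((r.N : ℝ) + r.N) ^ n := by
  have hCp : ∀ (p : Fin 4 × Fin 4) (z : Fin 4 → ℤ) (U : LGConfig 4 G), |plane G r p z U| ≤ (r.N : ℝ) :=
    fun p z U => abs_plaquetteObs_le_holds (ρ := r.ρ) r.mem_unitary 0 p.1 p.2 _
  exact abs_torusMomentStr_plane_le r hCp β S q x

end PlaneWeights

/-- **SG2: instantiation of the scaled shifted bound ⇒ (U).**  In units `a = m(β)`, normalised by
`N = refSquare r β S δ₀ a = rpSquare r β S ⌊δ₀/a⌋`: the floor and doubling clauses of `WindowRegularity` make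
`N > 0` and `a^{P+Q} ≤ C_W δ₀^P N`; Gaussian domination plus doubling give the separated bound
`|W^{q}(x)| ≤ (|C_G| n^γ √C_W √N (R₀/R)^P)ⁿ`, unitarity the sup bound `(2N_ρ)ⁿ`; the abstract bound at
`(δ₀, P, P + Q)` then yields `(K n^γ √N)ⁿ ‖F‖_{sn}` with `K = K_S (|C_G| √C_W + 2N_ρ √(C_W δ₀^P))`. -/
theorem uniformBound_of_scaledShiftedBound :
    (∀ δ : ℝ, 0 < δ → ∀ P E : ℕ, ∃ (K : ℝ) (s : ℕ), 0 ≤ K ∧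
    ∀ n : ℕ, 2 ≤ n → ∀ (L R₀ : ℕ) (a M B : ℝ) (W : (Fin n → Site 4) → ℝ)
      (y : (Fin n → Site 4) → (Fin n → EuclideanSpace ℝ (Fin 4))) (F : 𝓢((Fin n → EuclideanSpace ℝ (Fin 4)), ℂ)),
      0 < a → a ≤ 1 / 24 → a⁻¹ * a⁻¹ ≤ (L : ℝ) → 1 ≤ R₀ → (R₀ : ℝ) * a ≤ δ → 4 * R₀ + 4 < 2 * L + 1 →
      0 ≤ M → 0 ≤ B → (∀ x, |W x| ≤ M ^ n) →
      (∀ x ∈ Fintype.piFinset (fun _ : Fin n => box 4 L), ∀ R : ℕ, 1 ≤ R → R ≤ R₀ →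
        (∀ k l : Fin n, k ≠ l → ∃ μ : Fin 4, (2 * R + 1 : ℤ) < |x k μ - x l μ| ∧ |x k μ - x l μ| ≤ L) →
          |W x| ≤ (B * ((R₀ : ℝ) / R) ^ P) ^ n) →
      (∀ x l, ‖y x l - a • siteToE (x l)‖ ≤ 6 * a) → IsOffDiagonal F →
        a ^ (4 * n) * ‖∑ x ∈ Fintype.piFinset (fun _ : Fin n => box 4 L), ((W x : ℝ) : ℂ) * F (y x)‖ ≤
          K ^ n * (B ^ n + M ^ n * a ^ (E * n)) * schwartzNorm (s * n) F) →
    GaussianDomination → WindowRegularity → UniformBound := by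
  intro hSSB hGD hW2 G _ _ _ _ _ _ hG r β₁ C₁ c₂ m hgap δ₀ hδ₀
  -- (W2) at `c₀ := δ₀`: doubling exponent `P`, floor exponent `Q`
  obtain ⟨C_W, _c, _θ, β_W, P, Q, -, -, hW⟩ := hW2 G hG r β₁ C₁ c₂ m hgap δ₀ hδ₀
  -- Gaussian domination at `c₀ := δ₀`
  obtain ⟨C_G, β_G, γ, hGD'⟩ := hGD G hG r β₁ C₁ c₂ m hgap δ₀ hδ₀
  -- the abstract bound at `(δ₀, P, P + Q)`
  obtain ⟨K_S, s, hK_S, hS⟩ := hSSB δ₀ hδ₀ P (P + Q)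
  -- `GapData` (i): eventually `m β ≤ min (1/24) δ₀`
  have hε : (0 : ℝ) < min (1 / 24) δ₀ := lt_min (by norm_num) hδ₀
  obtain ⟨β_m, hβ_m⟩ := Filter.eventually_atTop.1 (hgap.2.1.eventually_le_const hε)
  -- the sup-bound constant
  obtain ⟨M, hM⟩ : ∃ M : ℝ, M = (r.N : ℝ) + r.N := ⟨_, rfl⟩
  have hM0 : 0 ≤ M := by rw [hM]; positivity
  refine ⟨K_S * (|C_G| * Real.sqrt C_W + M * Real.sqrt (C_W * δ₀ ^ P)),
    max (max 0 β₁) (max β_W (max β_G β_m)), γ, s, ?_⟩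
  intro β hβ n hn
  simp only [max_le_iff] at hβ
  obtain ⟨⟨hβ0, hββ₁⟩, hβW, hβG, hβm⟩ := hβ
  -- the unit `a = m β`
  have ha : 0 < m β := hgap.1 β hββ₁
  have ha24 : m β ≤ 1 / 24 := (hβ_m β hβm).trans (min_le_left _ _)
  have haδ : m β ≤ δ₀ := (hβ_m β hβm).trans (min_le_right _ _)
  have ha1 : m β ≤ 1 := ha24.trans (by norm_num)
  obtain ⟨S_W, hSW⟩ := hW β hβW
  obtain ⟨S_G, hSG⟩ := hGD' β hβG n hn
  -- the normalisation height `R₀ = ⌊δ₀ / a⌋`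
  obtain ⟨R₀, hR₀⟩ : ∃ R₀ : ℕ, R₀ = ⌊δ₀ / m β⌋₊ := ⟨_, rfl⟩
  have hR₀1 : 1 ≤ R₀ := by
    rw [hR₀]
    exact Nat.le_floor (by rw [Nat.cast_one]; exact (one_le_div ha).2 haδ)
  have hR₀le : (R₀ : ℝ) ≤ δ₀ / m β := by rw [hR₀]; exact Nat.floor_le (by positivity)
  have hR₀a : (R₀ : ℝ) * m β ≤ δ₀ := (le_div_iff₀ ha).1 hR₀le
  have hR₀pos : (0 : ℝ) < R₀ := by exact_mod_cast hR₀1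
  refine ⟨max S_W (max S_G (max ⌈(m β)⁻¹ * (m β)⁻¹⌉₊ (4 * R₀ + 8))), ?_⟩
  intro S hS'
  simp only [max_le_iff] at hS'
  obtain ⟨hSW', hSG', hSa, hSR⟩ := hS'
  have hLa : (m β)⁻¹ * (m β)⁻¹ ≤ (S : ℝ) := (Nat.le_ceil _).trans (by exact_mod_cast hSa)
  have h4R : 4 * R₀ + 4 < 2 * S + 1 := by omega
  have hR₀S : R₀ ≤ S := by omega
  obtain ⟨hdoub, -, hfloor⟩ := hSW S hSW'
  -- the reference square `N`
  have hrefl : refSquare r β S δ₀ (m β) = rpSquare r β S R₀ := by rw [hR₀]; rfl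
  have hN0 : 0 ≤ rpSquare r β S R₀ := rpSquare_nonneg r hβ0 hR₀1 hR₀S
  -- floor + doubling: `a^Q ≤ C_W R₀^P N`
  have haq : m β ^ Q ≤ C_W * (R₀ : ℝ) ^ P * rpSquare r β S R₀ := by
    have h := hfloor.trans (hdoub 1 R₀ le_rfl hR₀1 hR₀le)
    simpa only [Nat.cast_one, div_one] using h
  have haq0 : 0 < m β ^ Q := pow_pos ha Q
  have hprod : 0 < C_W * ((R₀ : ℝ) ^ P * rpSquare r β S R₀) := by
    rw [← mul_assoc]; exact haq0.trans_le haq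
  have hCW : 0 < C_W := pos_of_mul_pos_left hprod (by positivity)
  have hN : 0 < rpSquare r β S R₀ :=
    pos_of_mul_pos_right (pos_of_mul_pos_right hprod hCW.le) (by positivity)
  -- `a^{P+Q} ≤ C_W δ₀^P N`, hence `a^{P+Q} ≤ √(C_W δ₀^P) √N`
  have hapq : m β ^ (P + Q) ≤ C_W * δ₀ ^ P * rpSquare r β S R₀ := by
    have h1 : (R₀ : ℝ) ^ P ≤ (δ₀ / m β) ^ P := pow_le_pow_left₀ (by positivity) hR₀le P
    have h2 : m β ^ Q ≤ C_W * (δ₀ / m β) ^ P * rpSquare r β S R₀ := haq.trans (by gcongr)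
    rw [div_pow] at h2
    have hap : 0 < m β ^ P := pow_pos ha P
    rw [pow_add]
    calc m β ^ P * m β ^ Q ≤ m β ^ P * (C_W * (δ₀ ^ P / m β ^ P) * rpSquare r β S R₀) := by gcongr
      _ = C_W * δ₀ ^ P * rpSquare r β S R₀ := by field_simp
  have hapq' : m β ^ (P + Q) ≤ Real.sqrt (C_W * δ₀ ^ P) * Real.sqrt (rpSquare r β S R₀) := by
    rw [← Real.sqrt_mul (by positivity : 0 ≤ C_W * δ₀ ^ P)]
    apply Real.le_sqrt_of_sq_le
    calc (m β ^ (P + Q)) ^ 2 = m β ^ (P + Q) * m β ^ (P + Q) := sq _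
      _ ≤ m β ^ (P + Q) * 1 := by gcongr; exact pow_le_one₀ ha.le ha1
      _ = m β ^ (P + Q) := mul_one _
      _ ≤ _ := hapq
  refine ⟨hrefl ▸ hN, fun q hq y hy F hF => ?_⟩
  -- sup bound
  have hsup : ∀ x, |planeWeight r β S q x| ≤ M ^ n := fun x => hM ▸ abs_planeWeight_le r β S q x
  -- separated bound, `B := |C_G| n^γ √C_W √N`
  have hB0 : 0 ≤ |C_G| * (n : ℝ) ^ γ * Real.sqrt C_W * Real.sqrt (rpSquare r β S R₀) := by
    positivity
  have hsep : ∀ x ∈ Fintype.piFinset (fun _ : Fin n => box 4 S), ∀ R : ℕ, 1 ≤ R → R ≤ R₀ →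
      (∀ k l : Fin n, k ≠ l → ∃ μ : Fin 4, (2 * R + 1 : ℤ) < |x k μ - x l μ| ∧ |x k μ - x l μ| ≤ S) →
        |planeWeight r β S q x| ≤
          (|C_G| * (n : ℝ) ^ γ * Real.sqrt C_W * Real.sqrt (rpSquare r β S R₀) *
            ((R₀ : ℝ) / R) ^ P) ^ n := by
    intro x _ R hR1 hRR₀ hxs
    have hRδ : (R : ℝ) ≤ δ₀ / m β := le_trans (by exact_mod_cast hRR₀) hR₀le
    have h4R' : 4 * R + 4 < 2 * S + 1 := by omega
    have hg : |planeWeight r β S q x| ≤ (C_G * (n : ℝ) ^ γ * Real.sqrt (rpSquare r β S R)) ^ n := by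
      rw [planeWeight_eq_integral]
      exact hSG S hSG' R R q x hq hR1 le_rfl hRδ h4R' hxs
    have hd : rpSquare r β S R ≤ C_W * ((R₀ : ℝ) / R) ^ P * rpSquare r β S R₀ :=
      hdoub R R₀ hR1 hRR₀ hR₀le
    have hRpos : (0 : ℝ) < R := by exact_mod_cast hR1
    have hratio : 1 ≤ (R₀ : ℝ) / R := (one_le_div hRpos).2 (by exact_mod_cast hRR₀)
    have hsq : Real.sqrt (rpSquare r β S R) ≤
        Real.sqrt C_W * ((R₀ : ℝ) / R) ^ P * Real.sqrt (rpSquare r β S R₀) := by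
      calc Real.sqrt (rpSquare r β S R) ≤ Real.sqrt (C_W * ((R₀ : ℝ) / R) ^ P * rpSquare r β S R₀) :=
            Real.sqrt_le_sqrt hd
        _ = Real.sqrt C_W * Real.sqrt (((R₀ : ℝ) / R) ^ P) * Real.sqrt (rpSquare r β S R₀) := by
            rw [Real.sqrt_mul (by positivity : (0 : ℝ) ≤ C_W * ((R₀ : ℝ) / R) ^ P), Real.sqrt_mul hCW.le]
        _ ≤ Real.sqrt C_W * ((R₀ : ℝ) / R) ^ P * Real.sqrt (rpSquare r β S R₀) := by
            gcongr
            exact Real.sqrt_le_self_iff.2 (Or.inr (one_le_pow₀ hratio))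
    calc |planeWeight r β S q x| ≤ (C_G * (n : ℝ) ^ γ * Real.sqrt (rpSquare r β S R)) ^ n := hg
      _ ≤ |(C_G * (n : ℝ) ^ γ * Real.sqrt (rpSquare r β S R)) ^ n| := le_abs_self _
      _ = (|C_G| * (n : ℝ) ^ γ * Real.sqrt (rpSquare r β S R)) ^ n := by
          rw [abs_pow, abs_mul, abs_mul, abs_of_nonneg (by positivity : (0 : ℝ) ≤ (n : ℝ) ^ γ),
            abs_of_nonneg (Real.sqrt_nonneg _)]
      _ ≤ (|C_G| * (n : ℝ) ^ γ *
            (Real.sqrt C_W * ((R₀ : ℝ) / R) ^ P * Real.sqrt (rpSquare r β S R₀))) ^ n := by gcongr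
      _ = _ := by ring
  -- the abstract bound
  have hmain := hS n hn S R₀ (m β) M _ (planeWeight r β S q) y F ha ha24 hLa hR₀1 hR₀a h4R hM0 hB0 hsup
    hsep hy hF
  -- bookkeeping
  have hnγ : (1 : ℝ) ≤ (n : ℝ) ^ γ := one_le_pow₀ (by exact_mod_cast (show 1 ≤ n by omega))
  have hFn : 0 ≤ schwartzNorm (s * n) F := schwartzNorm_nonneg _ F
  have hn0 : n ≠ 0 := by omega
  have h2 : M ^ n * m β ^ ((P + Q) * n) ≤
      (M * Real.sqrt (C_W * δ₀ ^ P) * (n : ℝ) ^ γ * Real.sqrt (rpSquare r β S R₀)) ^ n := by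
    rw [pow_mul, ← mul_pow]
    refine pow_le_pow_left₀ (by positivity) ?_ n
    calc M * m β ^ (P + Q) ≤ M * (Real.sqrt (C_W * δ₀ ^ P) * Real.sqrt (rpSquare r β S R₀)) := by gcongr
      _ = M * Real.sqrt (C_W * δ₀ ^ P) * 1 * Real.sqrt (rpSquare r β S R₀) := by ring
      _ ≤ M * Real.sqrt (C_W * δ₀ ^ P) * (n : ℝ) ^ γ * Real.sqrt (rpSquare r β S R₀) := by gcongr
  have h1 : (|C_G| * (n : ℝ) ^ γ * Real.sqrt C_W * Real.sqrt (rpSquare r β S R₀)) ^ n =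
      (|C_G| * Real.sqrt C_W * (n : ℝ) ^ γ * Real.sqrt (rpSquare r β S R₀)) ^ n := by ring
  rw [hrefl]
  calc m β ^ (4 * n) * ‖∑ x ∈ Fintype.piFinset (fun _ : Fin n => box 4 S),
          ((planeWeight r β S q x : ℝ) : ℂ) * F (y x)‖
      ≤ K_S ^ n * ((|C_G| * (n : ℝ) ^ γ * Real.sqrt C_W * Real.sqrt (rpSquare r β S R₀)) ^ n +
          M ^ n * m β ^ ((P + Q) * n)) * schwartzNorm (s * n) F := hmain
    _ ≤ K_S ^ n * ((|C_G| * Real.sqrt C_W * (n : ℝ) ^ γ * Real.sqrt (rpSquare r β S R₀)) ^ n +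
          (M * Real.sqrt (C_W * δ₀ ^ P) * (n : ℝ) ^ γ * Real.sqrt (rpSquare r β S R₀)) ^ n) *
          schwartzNorm (s * n) F := by
        rw [h1]; gcongr
    _ ≤ K_S ^ n * (|C_G| * Real.sqrt C_W * (n : ℝ) ^ γ * Real.sqrt (rpSquare r β S R₀) +
          M * Real.sqrt (C_W * δ₀ ^ P) * (n : ℝ) ^ γ * Real.sqrt (rpSquare r β S R₀)) ^ n *
          schwartzNorm (s * n) F := by
        gcongr
        exact pow_add_pow_le (by positivity) (by positivity) hn0
    _ = (K_S * (|C_G| * Real.sqrt C_W + M * Real.sqrt (C_W * δ₀ ^ P)) * (n : ℝ) ^ γ *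
          Real.sqrt (rpSquare r β S R₀)) ^ n * schwartzNorm (s * n) F := by
        rw [show K_S * (|C_G| * Real.sqrt C_W + M * Real.sqrt (C_W * δ₀ ^ P)) * (n : ℝ) ^ γ *
            Real.sqrt (rpSquare r β S R₀) =
          K_S * (|C_G| * Real.sqrt C_W * (n : ℝ) ^ γ * Real.sqrt (rpSquare r β S R₀) +
            M * Real.sqrt (C_W * δ₀ ^ P) * (n : ℝ) ^ γ * Real.sqrt (rpSquare r β S R₀)) by ring, mul_pow]

end Summit.QuantumFields.YangMills.Cruxes.HypercubicLimit.ConditionalMeanTelescoping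

end
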